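import Summits.KontsevichZagierPeriods.KontsevichZagierPeriods.Theorems.LinRedNormalFormArrangementNormalFormSeparateTwoHIAlgebra

/-!
# The numerator along a thin sector: double Taylor sums as `usum`

(Line `janus-bands`, crux `ArrangementNormalForm`, stub `stub_separateTwoPos_hI`, part `HINum`.)
Pure algebra. At a base point, the numerator and its Taylor pieces are double sums
`∑_{i<N} (∑_{m<N'} c(i,m) ξ^m) λ^i` in `ξ = x − x₁` and `λ = y − ℓ(x)` (re-centred off the pole
line by `SepTwo.sum_recentre`). Along a thin sector in blown-up coordinates `(t, v)` either
`ξ = t P₀`, `λ = t u` (sectors of a finite slope, transversal `u = s + σ v`) or `ξ = t v q₀`,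
`λ = t p` (vertical sectors): in both cases the double sum is a `SepTwo.usum` of part
`HIAlgebra` over `T = range N ×ˢ range N'` with exponent map `π = Prod.fst` resp. `Prod.snd`
(`dsum_fst`, `dsum_snd`), the `i`-th piece being the partial sum over `im.1 = i` (`piece_fst`,
`piece_snd`), and `π` separates terms of equal total degree (`inj_fst`, `inj_snd`) — the format
of the ray theorems of part `HIRayMain`. Registered in literal form as `separateTwo_hiNum`.
-/

noncomputable section

open Finset

namespace Summit.KontsevichZagierPeriods.ArrangementNormalForm.JanusBands

namespace SepTwo

variable (c : ℕ × ℕ → ℝ) (N N' : ℕ)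

/-- Degree bound on the index set. -/
theorem deg_prod : ∀ im ∈ range N ×ˢ range N', im.1 + im.2 ≤ N + N' := fun im him => by
  obtain ⟨h1, h2⟩ := Finset.mem_product.1 him
  have := Finset.mem_range.1 h1; have := Finset.mem_range.1 h2; omega

/-- Exponent bound for `π = Prod.fst`. -/
theorem fst_le_prod : ∀ im ∈ range N ×ˢ range N', Prod.fst im ≤ N + N' := fun im him => by
  have := Finset.mem_range.1 (Finset.mem_product.1 him).1; omega

/-- Exponent bound for `π = Prod.snd`. -/
theorem snd_le_prod : ∀ im ∈ range N ×ˢ range N', Prod.snd im ≤ N + N' := fun im him => by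
  have := Finset.mem_range.1 (Finset.mem_product.1 him).2; omega

/-- `Prod.fst` separates terms of equal total degree. -/
theorem inj_fst (T : Finset (ℕ × ℕ)) : ∀ im ∈ T, ∀ im' ∈ T,
    im.1 + im.2 = im'.1 + im'.2 → Prod.fst im = Prod.fst im' → im = im' :=
  fun im _ im' _ h h1 => Prod.ext h1 (by omega)

/-- `Prod.snd` separates terms of equal total degree. -/
theorem inj_snd (T : Finset (ℕ × ℕ)) : ∀ im ∈ T, ∀ im' ∈ T,
    im.1 + im.2 = im'.1 + im'.2 → Prod.snd im = Prod.snd im' → im = im' :=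
  fun im _ im' _ h h2 => Prod.ext (by omega) h2

/-- **The double sum along a sector of finite slope** (`ξ = t P₀`, `λ = t u`). -/
theorem dsum_fst (P₀ t u : ℝ) :
    ∑ i ∈ range N, (∑ m ∈ range N', c (i, m) * (t * P₀) ^ m) * (t * u) ^ i =
      usum (range N ×ˢ range N') (fun im => c im * P₀ ^ im.2) Prod.fst t u := by
  unfold usum
  rw [Finset.sum_product]
  refine Finset.sum_congr rfl fun i _ => ?_
  rw [Finset.sum_mul]
  refine Finset.sum_congr rfl fun m _ => ?_
  rw [mul_pow, mul_pow, pow_add]; ring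

/-- **The `i`-th piece along a sector of finite slope.** -/
theorem piece_fst (P₀ t u : ℝ) (i : ℕ) (hi : i < N) :
    (∑ m ∈ range N', c (i, m) * (t * P₀) ^ m) * (t * u) ^ i =
      usum ((range N ×ˢ range N').filter fun im => im.1 = i) (fun im => c im * P₀ ^ im.2)
        Prod.fst t u := by
  unfold usum
  rw [Finset.sum_filter, Finset.sum_product]
  symm
  rw [Finset.sum_eq_single_of_mem i (Finset.mem_range.2 hi)
    (fun i' _ hne => Finset.sum_eq_zero fun m _ => if_neg hne),
    Finset.sum_congr rfl fun m _ => if_pos rfl, Finset.sum_mul]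
  refine Finset.sum_congr rfl fun m _ => ?_
  rw [mul_pow, mul_pow, pow_add]; ring

/-- **The double sum along a vertical sector** (`ξ = t v q₀`, `λ = t p`). -/
theorem dsum_snd (q₀ p t v : ℝ) :
    ∑ i ∈ range N, (∑ m ∈ range N', c (i, m) * (t * (v * q₀)) ^ m) * (t * p) ^ i =
      usum (range N ×ˢ range N') (fun im => c im * q₀ ^ im.2 * p ^ im.1) Prod.snd t v := by
  unfold usum
  rw [Finset.sum_product]
  refine Finset.sum_congr rfl fun i _ => ?_
  rw [Finset.sum_mul]
  refine Finset.sum_congr rfl fun m _ => ?_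
  rw [mul_pow, mul_pow, mul_pow, pow_add]; ring

/-- **The `i`-th piece along a vertical sector.** -/
theorem piece_snd (q₀ p t v : ℝ) (i : ℕ) (hi : i < N) :
    (∑ m ∈ range N', c (i, m) * (t * (v * q₀)) ^ m) * (t * p) ^ i =
      usum ((range N ×ˢ range N').filter fun im => im.1 = i)
        (fun im => c im * q₀ ^ im.2 * p ^ im.1) Prod.snd t v := by
  unfold usum
  rw [Finset.sum_filter, Finset.sum_product]
  symm
  rw [Finset.sum_eq_single_of_mem i (Finset.mem_range.2 hi)
    (fun i' _ hne => Finset.sum_eq_zero fun m _ => if_neg hne),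
    Finset.sum_congr rfl fun m _ => if_pos rfl, Finset.sum_mul]
  refine Finset.sum_congr rfl fun m _ => ?_
  rw [mul_pow, mul_pow, mul_pow, pow_add]; ring

/-- **The re-centred double sum along a sector of finite slope** (`λ = l₁ + t u`). -/
theorem dsum_fst_recentre (l₁ P₀ t u : ℝ) :
    ∑ i ∈ range N, (∑ m ∈ range N', c (i, m) * (t * P₀) ^ m) * (l₁ + t * u) ^ i =
      usum (range N ×ˢ range N') (fun im => recentre N c l₁ im * P₀ ^ im.2) Prod.fst t u := by
  rw [sum_recentre N N' c l₁ (t * P₀) (t * u)]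
  exact dsum_fst (recentre N c l₁) N N' P₀ t u

/-- **The re-centred double sum along a vertical sector** (`λ = l₁ + t p`). -/
theorem dsum_snd_recentre (l₁ q₀ p t v : ℝ) :
    ∑ i ∈ range N, (∑ m ∈ range N', c (i, m) * (t * (v * q₀)) ^ m) * (l₁ + t * p) ^ i =
      usum (range N ×ˢ range N') (fun im => recentre N c l₁ im * q₀ ^ im.2 * p ^ im.1)
        Prod.snd t v := by
  rw [sum_recentre N N' c l₁ (t * (v * q₀)) (t * p)]
  exact dsum_snd (recentre N c l₁) N N' q₀ p t v

/-- Non-vanishing of the scaled coefficients (finite slope). -/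
theorem exists_ne_zero_fst {c' : ℕ × ℕ → ℝ} {T : Finset (ℕ × ℕ)} (h : ∃ im ∈ T, c' im ≠ 0)
    {P₀ : ℝ} (hP : P₀ ≠ 0) : ∃ im ∈ T, c' im * P₀ ^ im.2 ≠ 0 := by
  obtain ⟨im, him, hc⟩ := h
  exact ⟨im, him, mul_ne_zero hc (pow_ne_zero _ hP)⟩

/-- Non-vanishing of the scaled coefficients (vertical). -/
theorem exists_ne_zero_snd {c' : ℕ × ℕ → ℝ} {T : Finset (ℕ × ℕ)} (h : ∃ im ∈ T, c' im ≠ 0)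
    {q₀ p : ℝ} (hq : q₀ ≠ 0) (hp : p ≠ 0) : ∃ im ∈ T, c' im * q₀ ^ im.2 * p ^ im.1 ≠ 0 := by
  obtain ⟨im, him, hc⟩ := h
  exact ⟨im, him, mul_ne_zero (mul_ne_zero hc (pow_ne_zero _ hq)) (pow_ne_zero _ hp)⟩

/-- If all coefficients vanish, all pieces vanish. -/
theorem inner_eq_zero (h : ∀ im ∈ range N ×ˢ range N', c im = 0) (i : ℕ) (hi : i < N) (ξ : ℝ) :
    ∑ m ∈ range N', c (i, m) * ξ ^ m = 0 :=
  Finset.sum_eq_zero fun m hm => by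
    rw [h (i, m) (Finset.mem_product.2 ⟨Finset.mem_range.2 hi, hm⟩), zero_mul]

/-- A bound for the pieces on a bounded range: `|∑ c(i,m) ξ^m| ≤ ∑ |c(i,m)|` for `|ξ| ≤ 1`. -/
theorem abs_inner_le {ξ : ℝ} (hξ : |ξ| ≤ 1) (i : ℕ) :
    |∑ m ∈ range N', c (i, m) * ξ ^ m| ≤ ∑ m ∈ range N', |c (i, m)| :=
  (Finset.abs_sum_le_sum_abs _ _).trans (Finset.sum_le_sum fun m _ => by
    rw [abs_mul, abs_pow]
    exact (mul_le_mul_of_nonneg_left (pow_le_one₀ (abs_nonneg _) hξ) (abs_nonneg _)).trans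
      (le_of_eq (mul_one _)))

end SepTwo

/-- **The numerator along a thin sector of finite slope** (registered part of
`stub_separateTwoPos_hI`; literal form of `SepTwo.dsum_fst`): with `ξ = t P₀` and `λ = t u`
the double Taylor sum `∑_{i<N} (∑_{m<N'} c(i,m) ξ^m) λ^i` is the double sum
`∑_{im} (c im · P₀^{im.2}) t^{im.1+im.2} u^{im.1}` of part `HIAlgebra`. -/
theorem separateTwo_hiNum (c : ℕ × ℕ → ℝ) (N N' : ℕ) (P₀ t u : ℝ) : ∑ i ∈ Finset.range N, (∑ m ∈ Finset.range N', c (i, m) * (t * P₀) ^ m) * (t * u) ^ i = ∑ im ∈ Finset.range N ×ˢ Finset.range N', c im * P₀ ^ im.2 * t ^ (im.1 + im.2) * u ^ (Prod.fst im) := by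
  exact SepTwo.dsum_fst c N N' P₀ t u

end Summit.KontsevichZagierPeriods.ArrangementNormalForm.JanusBands
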